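import Summits.QuantumFields.YangMills.Theorems.UnitScaleTiltFluctuationComparisonRegPrGlobalSlackKernelLegWeighted
import HarnessLib

/-!
# `UnitScaleTiltFluctuationComparisonRegPrGlobalSlackKernelLegWeightedV3` — THE NON-χ TWINS OF THE PER-RUN SOCKETS: the REGISTERED stub 3⁗ of the skeleton OF RECORD v5k
# (`stub_globalTwoRunSlackFam`, over `OfV3At` / `PkgAtV3` / `dataOfV3 p (canonPolymer p)`) FROM OWN-INDEXED PER-RUN ROWS, BY NAME (crux `FluctuationComparisonRegPrIntL`,
# stmt-QuantumFields-20520; width seat ym-ust-20520-w3 g0 — ★ym-ust-20520-w1 g0's «NEXT NAMED LEMMA FOR w3» 23:42:23Z, insurance for the registry while the v5kC pen (C3) is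
# unexecuted; YM₃ on the 3-torus is ladder rung R3, not the Clay problem)

WHY.  ★w1 g0's per-run reading of 3⁗χ (`K1aLegRowsOwnAChi ⟹ K1aLegRowsOwnEChi ⟹ K1aLegRowsEChi ⟹ K1aChartRowsKChi ⟹ ⟨3⁗χ⟩`, `…KernelLegWeighted` p585428) is typed over the
χ-record (`OfV3ChiAt`, `PkgAtV3Chi`, datum `dataOfV3chi p (canonPolymerCore (toCore ∘ p))`) — the currency of the PEN v5kC.  The skeleton OF RECORD today is v5k, whose stub 3⁗
`stub_globalTwoRunSlackFam` reads the OLD record (`OfV3At`, `PkgAtV3`, datum `dataOfV3 p (canonPolymer p)`, term function `canonPT p`).  Every row-level theorem of ★w1's files is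
generic in the datum `D` or stated over the data CORE `q : ∀ K, PkgCoreV3`, and lane A's objects ARE the core ones of the projected family (`dataOfV3_eq_dataOfCoreV3` = `rfl`,
`canonPolymer_eq_core`, `canonPT_eq_core`, `residualRem_eq_core`), so only the SOCKET TEXTS change (token map reversed).  This file types them:

* §1 geometry at lane A's canonical datum: `dataOfV3_canon_eq_core`, `treeLenRefinedOn_canon` (★w1's (M6) transported), and the own ⟹ record reductions at `dataOfV3 p (canonPolymer p)`
  (`kernelRefΦ_canon_of_own`, `cfgRefΦ_canon_of_own`, `remainderSmallΦ_canon_of_own`, `cfgDistΦ_canon_of_own`);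
* §2 **`K1aLegRowsE`** (weighted op-norm kernel row `KernelLegΦ`, the other four leg rows of lane A's `K1aLegRowsR`), `k1aChartRowsK_of_legRowsE` (⟹ lane A's `K1aChartRowsK`,
  p545118, by the rescaled pair), `globalTwoRunSlackFam_of_k1aLegRowsE`;
* §3 **`K1aLegRowsOwnE`** / **`K1aLegRowsOwnA`** (five `∀ K`-rows about ONE run each; reference objects `Ψ` height-free, `BR` coherent, BEFORE the (α) hypothesis),
  `k1aLegRowsE_of_OwnE`, `k1aLegRowsOwnE_of_OwnA`, and the capstones **`globalTwoRunSlackFam_of_k1aLegRowsOwnE`** / **`globalTwoRunSlackFam_of_k1aLegRowsOwnA`** :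
  ⟨THE REGISTERED TEXT OF `stub_globalTwoRunSlackFam` (skeleton v5k `Cruxes/FluctuationComparisonRegPrIntL/Lines/birth_v5k.lean`) VERBATIM⟩.
HONEST FRAMING.  Hypothesis schemas + the reductions of ★w1's χ-files re-addressed; nothing of [Balaban1985UV3]/[King1986] is asserted; registry untouched
(`--supports stmt-QuantumFields-20520`); no claim about the crux, d = 4 or the mass gap.

References: C. King, CMP 102 (1986) 649–677 [King1986] (Thm 3.4 (3.9) p.656, Prop. 3.6 (3.56) p.662, (3.58)–(3.61) p.663, Prop. 3.9 (3.71)–(3.74) pp.664–665); T. Bałaban,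
CMP 102 (1985) 255–275 [Balaban1985UV3] ((24)–(25) p.262, (29)–(30) p.263, (33)–(34) p.264, (43)–(47) pp.266–267, (57) p.270); CMP 109 (1987) 249–301 [Balaban1987RG1] ((0.1) p.251).
-/

set_option autoImplicit false

noncomputable section

open scoped BigOperators
open Finset
open Literature.MathematicalPhysics.QuantumFieldTheory.Balaban1983to89
open Literature.MathematicalPhysics.QuantumFieldTheory.Balaban1983to89.T3ContinuumYM3Torus
open Literature.MathematicalPhysics.QuantumFieldTheory.Balaban1983to89.T3UnitScaleTilt
open Literature.MathematicalPhysics.QuantumFieldTheory.Balaban1983to89.T3LevelShift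
open Literature.MathematicalPhysics.QuantumFieldTheory.Balaban1983to89.T3AlphaInputsAC
open Literature.MathematicalPhysics.QuantumFieldTheory.Balaban1983to89.T3AlphaPolymerSocket
open Literature.MathematicalPhysics.QuantumFieldTheory.Balaban1983to89.T3AlphaInputsACTwoRun
open Literature.MathematicalPhysics.QuantumFieldTheory.Balaban1983to89.T3AlphaInputsACTwoRunLevel
open Literature.MathematicalPhysics.QuantumFieldTheory.Balaban1983to89.B12TreeDecay (kappa₀ kappa₀_nonneg)
open Literature.MathematicalPhysics.QuantumFieldTheory.Balaban1985CMP102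
open Literature.MathematicalPhysics.QuantumFieldTheory.Balaban1985CMP102.Setting
open Summit.QuantumFields.Balaban3D.Carriers
open Summit.QuantumFields.Balaban3D.Proofs.Primitives
open Summit.QuantumFields.Balaban3D.Proofs.GroupModelLieC (lieC)
open Summit.QuantumFields.Balaban3D.Proofs.Representation33 (jet26)
open Summit.QuantumFields.YangMills.Theorems
open Summit.QuantumFields.YangMills.Theorems.GlobalSlackKernelMatching
open Summit.QuantumFields.YangMills.Theorems.GlobalSlackCanonicalPolymers

namespace Summit.QuantumFields.YangMills.Theorems.GlobalSlackKernelLeg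

/-! ## §1 Geometry at lane A's canonical datum `dataOfV3 p (canonPolymer p)` (transported from the core) -/

section Canon

variable {F : T3Family} {𝔠 : AlphaConsts F.L (suGroupModel 2).N} {γ : ℝ} {hγ : 0 < γ} {hγ1 : γ ≤ (min 𝔠.gamma0 1) ^ 2}

/-- **LANE A's CANONICAL DATUM IS THE CORE DATUM OF THE PROJECTED FAMILY** (`dataOfV3_eq_dataOfCoreV3` = `rfl`, `canonPolymer_eq_core`). [cite: Balaban1985UV3, (43) p.266] -/
theorem dataOfV3_canon_eq_core (p : ∀ K, AlphaInputsT3AC.PkgAtV3 F 𝔠 γ hγ hγ1 K) :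
    AlphaInputsT3AC.dataOfV3 p (canonPolymer p) = AlphaInputsT3AC.dataOfCoreV3 (fun K => (p K).toCore) (canonPolymerCore fun K => (p K).toCore) := by
  rw [canonPolymer_eq_core]
  rfl

/-- **(M6) AT LANE A's CANONICAL DATUM**: tree length does not decrease under the refinement on the listed domains (★w1 g0's `treeLenRefinedOn_canonCore`, transported).
[cite: Balaban1985UV3, (24)-(25) p.262; Balaban1987RG1, (0.1) p.251] -/
theorem treeLenRefinedOn_canon (p : ∀ K, AlphaInputsT3AC.PkgAtV3 F 𝔠 γ hγ hγ1 K) : TreeLenRefinedOn (AlphaInputsT3AC.dataOfV3 p (canonPolymer p)) := by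
  rw [dataOfV3_canon_eq_core]
  exact treeLenRefinedOn_canonCore fun K => (p K).toCore

/-- `LocMatched` at lane A's canonical datum, from the core row (`locMatched_canonCore`, transported). [cite: Balaban1987RG1, (0.1) p.251] -/
theorem locMatched_canon_of_core (p : ∀ K, AlphaInputsT3AC.PkgAtV3 F 𝔠 γ hγ hγ1 K) : LocMatched (AlphaInputsT3AC.dataOfV3 p (canonPolymer p)) := by
  rw [dataOfV3_canon_eq_core]
  exact locMatched_canonCore fun K => (p K).toCore

/-- **THE OWN-INDEXED KERNEL ROW GIVES `KernelRefΦ` AT LANE A's CANONICAL DATUM** (canonical leg distance; decay `κ ≥ 0`; `0 ≤ C`, `0 ≤ a`).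
[cite: King1986, Prop. 3.6 (3.56) p.662; Balaban1985UV3, (24)-(25) p.262] -/
theorem kernelRefΦ_canon_of_own (p : ∀ K, AlphaInputsT3AC.PkgAtV3 F 𝔠 γ hγ hγ1 K) {Φ Ψ : ChartFam ↥(lieC (suGroupModel 2)) F} {κ' κ a C : ℝ}
    (hκ : 0 ≤ κ) (hC : 0 ≤ C) (ha : 0 ≤ a)
    (h : KernelRefOwnΦ (AlphaInputsT3AC.dataOfV3 p (canonPolymer p)) Φ Ψ (canonLegDist F) κ' κ a C) :
    KernelRefΦ (AlphaInputsT3AC.dataOfV3 p (canonPolymer p)) Φ Ψ (canonLegDist F) κ' κ a C :=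
  kernelRefΦ_of_own (canonLegDist_matched F) (treeLenRefinedOn_canon p) hκ hC ha F.hL.2.le h

/-- **THE OWN-INDEXED LOOP-VARIABLE ROW GIVES `CfgRefΦ` AT LANE A's CANONICAL DATUM** (canonical leg distance; the record's window letters). [cite: King1986, Prop. 3.9 (3.71)-(3.72) pp.664-665] -/
theorem cfgRefΦ_canon_of_own (p : ∀ K, AlphaInputsT3AC.PkgAtV3 F 𝔠 γ hγ hγ1 K) {B BR : CfgFam ↥(lieC (suGroupModel 2)) F} {a C_B : ℝ}
    (hCB : 0 ≤ C_B) (ha : 0 ≤ a)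
    (h : CfgRefOwnΦ (AlphaInputsT3AC.dataOfV3 p (canonPolymer p)) B BR (canonLegDist F) 𝔠.b₀ 𝔠.p₀ a C_B) :
    CfgRefΦ (AlphaInputsT3AC.dataOfV3 p (canonPolymer p)) B BR (canonLegDist F) 𝔠.b₀ 𝔠.p₀ a C_B :=
  cfgRefΦ_of_own (locMatched_canon_of_core p) (canonLegDist_matched F) (canonLegDist_nonneg F) F.hL.2.le hγ
    (hγ1.trans (sq_min_one_le _ 𝔠.gamma0_pos)) 𝔠.b₀_pos hCB ha h

/-- The own-indexed residual row gives `RemainderSmallΦ` at lane A's canonical datum (decay `κ ≥ 0`, `C_R ≥ 0`). [cite: Balaban1985UV3, (57) p.270] -/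
theorem remainderSmallΦ_canon_of_own (p : ∀ K, AlphaInputsT3AC.PkgAtV3 F 𝔠 γ hγ hγ1 K) {R : RemFam F} {κ C_R : ℝ} (hκ : 0 ≤ κ) (hCR : 0 ≤ C_R)
    (h : RemainderSmallOwnΦ (AlphaInputsT3AC.dataOfV3 p (canonPolymer p)) R 𝔠.b₀ 𝔠.p₀ κ C_R) :
    RemainderSmallΦ (AlphaInputsT3AC.dataOfV3 p (canonPolymer p)) R 𝔠.b₀ 𝔠.p₀ κ C_R :=
  remainderSmallΦ_of_own (locMatched_canon_of_core p) (treeLenRefinedOn_canon p) hκ hCR F.hL.2.le hγ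
    (hγ1.trans (sq_min_one_le _ 𝔠.gamma0_pos)) 𝔠.b₀_pos h

/-- The own-indexed (44) row gives `CfgDistΦ` at lane A's canonical datum (canonical leg distance). [cite: Balaban1985UV3, (44) p.267] -/
theorem cfgDistΦ_canon_of_own (p : ∀ K, AlphaInputsT3AC.PkgAtV3 F 𝔠 γ hγ hγ1 K) {B : CfgFam ↥(lieC (suGroupModel 2)) F} {C_s : ℝ}
    (h : CfgDistOwnΦ (AlphaInputsT3AC.dataOfV3 p (canonPolymer p)) B (canonLegDist F) 𝔠.b₀ 𝔠.p₀ C_s) :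
    CfgDistΦ (AlphaInputsT3AC.dataOfV3 p (canonPolymer p)) B (canonLegDist F) 𝔠.b₀ 𝔠.p₀ C_s :=
  cfgDistΦ_of_own (locMatched_canon_of_core p) (canonLegDist_matched F) h

end Canon

/-! ## §2 The weighted-kernel socket over the OLD record, and the registered v5k text -/

/-- **THE K1a LEG ROWS WITH THE WEIGHTED OPERATOR-NORM KERNEL ROW, OLD RECORD** (hypothesis schema, never asserted): ★w1's `K1aLegRowsEChi` with the token map reversed
(`OfV3At`, `PkgAtV3`, datum `dataOfV3 p (canonPolymer p)`, residual rest `residualRem p Φ e B`) — a weight rate `κ′ > 0`, nonnegative constants, a threshold, and for every family /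
coupling / inhabited v3 package a coherent `p` and ONE `(Φ, e, B)` with K1a `FlatKernelLegCauchyΦ`, `KernelLegΦ`, the residual row, (44) `CfgDistΦ`, `CfgDistCauchyΦ`, all at the
record's full decay `𝔠.κ` and the canonical leg distance. [cite: Balaban1985UV3, (43)-(45) pp.266-267, (57) p.270; King1986, Thm 3.4 (3.9) p.656, Prop. 3.6 (3.56) p.662] -/
def K1aLegRowsE (L : ℕ) (𝔠 : AlphaConsts L (suGroupModel 2).N) (a₀ a₁ a : ℝ) : Prop :=
  ∃ (κ' C C_E C_R C_s C_B γB : ℝ), 0 < κ' ∧ 0 ≤ C ∧ 0 ≤ C_E ∧ 0 ≤ C_R ∧ 0 ≤ C_s ∧ 0 ≤ C_B ∧ 0 < γB ∧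
    ∀ (F : T3Family) (γ : ℝ) (hF : F.L = L) (hγ : 0 < γ), γ ≤ γB → ∀ (hγ1 : γ ≤ (min (hF ▸ 𝔠).gamma0 1) ^ 2),
      AlphaInputsT3AC.OfV3At F (hF ▸ 𝔠) a₀ a₁ →
        ∃ (p : ∀ K, AlphaInputsT3AC.PkgAtV3 F (hF ▸ 𝔠) γ hγ hγ1 K), (∀ K, (p K).a₀ = a₀ ∧ (p K).a₁ = a₁) ∧
          ∃ (Φ : ChartFam ↥(lieC (suGroupModel 2)) F) (e : VacFam F) (B : CfgFam ↥(lieC (suGroupModel 2)) F),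
            FlatKernelLegCauchyΦ (AlphaInputsT3AC.dataOfV3 p (canonPolymer p)) Φ (canonLegDist F) κ' (hF ▸ 𝔠).κ a C ∧
            KernelLegΦ (AlphaInputsT3AC.dataOfV3 p (canonPolymer p)) Φ (canonLegDist F) κ' (hF ▸ 𝔠).κ C_E ∧
            RemainderSmallΦ (AlphaInputsT3AC.dataOfV3 p (canonPolymer p)) (residualRem p Φ e B) (hF ▸ 𝔠).b₀ (hF ▸ 𝔠).p₀ (hF ▸ 𝔠).κ C_R ∧
            CfgDistΦ (AlphaInputsT3AC.dataOfV3 p (canonPolymer p)) B (canonLegDist F) (hF ▸ 𝔠).b₀ (hF ▸ 𝔠).p₀ C_s ∧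
            CfgDistCauchyΦ (AlphaInputsT3AC.dataOfV3 p (canonPolymer p)) B (canonLegDist F) (hF ▸ 𝔠).b₀ (hF ▸ 𝔠).p₀ a C_B

/-- **THE WEIGHTED LEG ROWS GIVE LANE A's CHART ROWS AT THE RECORD'S FULL DECAY** (`K1aChartRowsK`, p545118) — through the rescaled pair `(Φ∘D_w, D_w⁻¹B)` and the residual rest
(`taylorSplitΦ_residual`, `taylorSplitΦ_rescaleW`, `flatKernelCauchyΦ_rescaleW`, `kernelSizeΦ_rescaleW`, `cfgSizeΦ_rescaleW`, `cfgCauchyΦ_rescaleW`; constant `·(1 + κ′⁻¹)` on the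
configuration rows). [cite: Balaban1985UV3, (43)-(45) pp.266-267; King1986, Prop. 3.6 (3.56) p.662] -/
theorem k1aChartRowsK_of_legRowsE {L : ℕ} {𝔠 : AlphaConsts L (suGroupModel 2).N} {a₀ a₁ a : ℝ} (h : K1aLegRowsE L 𝔠 a₀ a₁ a) :
    K1aChartRowsK L 𝔠 a₀ a₁ a := by
  obtain ⟨κ', C, C_E, C_R, C_s, C_B, γB, hκ', hC, hCE, hCR, hCs, hCB, hγB, hall⟩ := h
  have hk1 : 0 ≤ 1 + κ'⁻¹ := by positivity
  refine ⟨C, C_E, C_R, C_s * (1 + κ'⁻¹), C_B * (1 + κ'⁻¹), γB, hC, hCE, hCR, mul_nonneg hCs hk1, mul_nonneg hCB hk1, hγB,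
    fun F γ hF hγ hγle hγ1 hOf => ?_⟩
  subst hF
  obtain ⟨p, hp, Φ, e, B, hK, hE, hR, hS, hBC⟩ := hall F γ rfl hγ hγle hγ1 hOf
  have hL : 1 ≤ F.L := F.hL.2.le
  have hγ1' : γ ≤ 1 := hγ1.trans (sq_min_one_le _ 𝔠.gamma0_pos)
  have hn := canonLegDist_nonneg F
  have hm := canonLegDist_matched F
  exact ⟨p, hp, rescaleΦw (canonLegDist F) κ' Φ, e, rescaleBw (canonLegDist F) κ' B, residualRem p Φ e B,
    taylorSplitΦ_rescaleW (canonLegDist F) κ' (taylorSplitΦ_residual p Φ e B),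
    flatKernelCauchyΦ_rescaleW hm hK, kernelSizeΦ_rescaleW hE, hR,
    cfgSizeΦ_rescaleW hL hγ hγ1' 𝔠.b₀_pos hn hm hκ' hCs hS, cfgCauchyΦ_rescaleW hL hγ hγ1' 𝔠.b₀_pos hn hm hκ' hCB hBC⟩

/-- **THE REGISTERED v5k STUB 3⁗ `stub_globalTwoRunSlackFam` FROM THE WEIGHTED LEG ROWS, BY NAME** (`globalTwoRunSlackFam_of_k1aChartRowsK ∘ k1aChartRowsK_of_legRowsE`).
[cite: King1986, Thm 3.4 (3.9) p.656, Prop. 3.6 (3.56) p.662; Balaban1985UV3, (43)-(46) pp.266-267, (57) p.270] -/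
theorem globalTwoRunSlackFam_of_k1aLegRowsE
    (h : ∀ (L : ℕ), Odd L → 7 ≤ L → ∀ (𝔠 : AlphaConsts L (suGroupModel 2).N) (a₀ a₁ : ℝ), 0 < a₀ → 0 < a₁ → 𝔠.B₃ * a₁ ≤ a₀ →
      ∃ a : ℝ, 0 < a ∧ a < 1 ∧ K1aLegRowsE L 𝔠 a₀ a₁ a) :
    ∀ (L : ℕ), Odd L → 7 ≤ L → ∀ (𝔠 : Summit.QuantumFields.Balaban3D.Proofs.Primitives.AlphaConsts L (Summit.QuantumFields.Balaban3D.Carriers.suGroupModel 2).N)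
      (a₀ a₁ : ℝ), 0 < a₀ → 0 < a₁ → 𝔠.B₃ * a₁ ≤ a₀ →
      ∃ a : ℝ, 0 < a ∧ ∃ γB : ℝ, 0 < γB ∧ ∀ (F : T3Family) (γ : ℝ) (hF : F.L = L) (hγ : 0 < γ), γ ≤ γB →
        ∀ (hγ1 : γ ≤ (min (hF ▸ 𝔠).gamma0 1) ^ 2),
          Summit.QuantumFields.YangMills.Theorems.AlphaInputsT3AC.OfV3At F (hF ▸ 𝔠) a₀ a₁ →
          ∃ (p : ∀ K, Summit.QuantumFields.YangMills.Theorems.AlphaInputsT3AC.PkgAtV3 F (hF ▸ 𝔠) γ hγ hγ1 K),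
            (∀ K, (p K).a₀ = a₀ ∧ (p K).a₁ = a₁) ∧
            ∃ (π : Summit.QuantumFields.YangMills.Theorems.AlphaInputsT3AC.PolymerT3 F) (σ : ℕ) (C : ℝ), 7 ≤ σ ∧ 0 ≤ C ∧
              Summit.QuantumFields.YangMills.Theorems.GlobalSlack.GlobalSupRateTSlack (Summit.QuantumFields.YangMills.Theorems.AlphaInputsT3AC.dataOfV3 p π) (hF ▸ 𝔠).b₀ (hF ▸ 𝔠).p₀ a σ C :=
  globalTwoRunSlackFam_of_k1aChartRowsK fun L hLo h7 𝔠 a₀ a₁ ha0 ha1 hw => by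
    obtain ⟨a, ha, ha1', hc⟩ := h L hLo h7 𝔠 a₀ a₁ ha0 ha1 hw
    exact ⟨a, ha, ha1', k1aChartRowsK_of_legRowsE hc⟩

/-! ## §3 The all-own per-run forms over the OLD record, and the registered v5k text -/

/-- **THE REGISTERED 3⁗ PER RUN WITH THE WEIGHTED KERNEL ROW, OLD RECORD** (hypothesis schema, never asserted): ★w1's `K1aLegRowsOwnEChi` with the token map reversed —
five rows, each a `∀ K`-statement about ONE run's v3 package: `KernelRefOwnΦ`, `KernelLegΦ`, `RemainderSmallOwnΦ … (residualRem p …)`, `CfgDistOwnΦ`, `CfgRefOwnΦ`; reference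
objects `Ψ` (height-free), `BR` (coherent) BEFORE the (α) hypothesis `OfV3At`. [cite: King1986, Thm 3.4 (3.9) p.656, Prop. 3.6 (3.56) p.662, Prop. 3.9 (3.71)-(3.74) pp.664-665; Balaban1985UV3, (43)-(45) pp.266-267, (57) p.270] -/
def K1aLegRowsOwnE (L : ℕ) (𝔠 : AlphaConsts L (suGroupModel 2).N) (a₀ a₁ a : ℝ) : Prop :=
  ∃ (κ' C C_E C_R C_s C_B γB : ℝ), 0 < κ' ∧ 0 ≤ C ∧ 0 ≤ C_E ∧ 0 ≤ C_R ∧ 0 ≤ C_s ∧ 0 ≤ C_B ∧ 0 < γB ∧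
    ∀ (F : T3Family) (γ : ℝ) (hF : F.L = L) (hγ : 0 < γ), γ ≤ γB → ∀ (hγ1 : γ ≤ (min (hF ▸ 𝔠).gamma0 1) ^ 2),
      ∃ (Ψ : ChartFam ↥(lieC (suGroupModel 2)) F) (BR : CfgFam ↥(lieC (suGroupModel 2)) F), KerHeightFree Ψ ∧ RefCfgCoherent BR ∧
        (AlphaInputsT3AC.OfV3At F (hF ▸ 𝔠) a₀ a₁ →
          ∃ (p : ∀ K, AlphaInputsT3AC.PkgAtV3 F (hF ▸ 𝔠) γ hγ hγ1 K), (∀ K, (p K).a₀ = a₀ ∧ (p K).a₁ = a₁) ∧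
            ∃ (Φ : ChartFam ↥(lieC (suGroupModel 2)) F) (e : VacFam F) (B : CfgFam ↥(lieC (suGroupModel 2)) F),
              KernelRefOwnΦ (AlphaInputsT3AC.dataOfV3 p (canonPolymer p)) Φ Ψ (canonLegDist F) κ' (hF ▸ 𝔠).κ a C ∧
              KernelLegΦ (AlphaInputsT3AC.dataOfV3 p (canonPolymer p)) Φ (canonLegDist F) κ' (hF ▸ 𝔠).κ C_E ∧
              RemainderSmallOwnΦ (AlphaInputsT3AC.dataOfV3 p (canonPolymer p)) (residualRem p Φ e B) (hF ▸ 𝔠).b₀ (hF ▸ 𝔠).p₀ (hF ▸ 𝔠).κ C_R ∧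
              CfgDistOwnΦ (AlphaInputsT3AC.dataOfV3 p (canonPolymer p)) B (canonLegDist F) (hF ▸ 𝔠).b₀ (hF ▸ 𝔠).p₀ C_s ∧
              CfgRefOwnΦ (AlphaInputsT3AC.dataOfV3 p (canonPolymer p)) B BR (canonLegDist F) (hF ▸ 𝔠).b₀ (hF ▸ 𝔠).p₀ a C_B)

/-- **THE ALL-OWN WEIGHTED FORM GIVES THE WEIGHTED SOCKET, OLD RECORD**: `K1aLegRowsOwnE → K1aLegRowsE` (`0 ≤ a`; K1a by `flatKernelLegCauchyΦ_of_ref ∘ kernelRefΦ_canon_of_own`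
(constant `2C`), the residual and (44) rows by `remainderSmallΦ_canon_of_own` / `cfgDistΦ_canon_of_own`, `CfgDistCauchyΦ` by `cfgDistCauchyΦ_of_ref ∘ cfgRefΦ_canon_of_own`
(constant `2C_B`)). [cite: King1986, Prop. 3.6 (3.56) p.662, Prop. 3.9 (3.71)-(3.74) pp.664-665; Balaban1985UV3, (24)-(25) p.262] -/
theorem k1aLegRowsE_of_OwnE {L : ℕ} {𝔠 : AlphaConsts L (suGroupModel 2).N} {a₀ a₁ a : ℝ} (ha : 0 ≤ a) (h : K1aLegRowsOwnE L 𝔠 a₀ a₁ a) :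
    K1aLegRowsE L 𝔠 a₀ a₁ a := by
  obtain ⟨κ', C, C_E, C_R, C_s, C_B, γB, hκ', hC, hCE, hCR, hCs, hCB, hγB, hall⟩ := h
  refine ⟨κ', 2 * C, C_E, C_R, C_s, 2 * C_B, γB, hκ', by linarith, hCE, hCR, hCs, by linarith, hγB, fun F γ hF hγ hγle hγ1 hOf => ?_⟩
  obtain ⟨Ψ, BR, hΨ, hBR, himp⟩ := hall F γ hF hγ hγle hγ1
  obtain ⟨p, hp, Φ, e, B, hK, hE, hR, hS, hBC⟩ := himp hOf
  subst hF
  have hκ0 : 0 ≤ 𝔠.κ := by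
    have h0 : 0 ≤ kappa₀ (4 * 2 ^ 3) (2 * 3) := kappa₀_nonneg (by norm_num) _
    linarith [𝔠.kappa_ge]
  exact ⟨p, hp, Φ, e, B, flatKernelLegCauchyΦ_of_ref hΨ (kernelRefΦ_canon_of_own p hκ0 hC ha hK), hE,
    remainderSmallΦ_canon_of_own p hκ0 hCR hR, cfgDistΦ_canon_of_own p hS,
    cfgDistCauchyΦ_of_ref hBR (cfgRefΦ_canon_of_own p hCB ha hBC)⟩

/-- **THE REGISTERED 3⁗ PER RUN AT DISPLAY LEVEL, OLD RECORD** (hypothesis schema, never asserted): ★w1's `K1aLegRowsOwnAChi` with the token map reversed — `K1aLegRowsOwnE` with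
the kernel row replaced by LEG-WEIGHTED ANALYTICITY of the charts, `ChartAnalyticΦ D (rescaleΦw (canonLegDist F) κ′ Φ) 𝔠.κ ρ C_A`; the other four rows unchanged.
[cite: Balaban1985UV3, (25) p.262, (29)-(30) p.263, (33)-(34) p.264, (43)-(45) pp.266-267, (57) p.270; King1986, Prop. 3.6 (3.56) p.662] -/
def K1aLegRowsOwnA (L : ℕ) (𝔠 : AlphaConsts L (suGroupModel 2).N) (a₀ a₁ a : ℝ) : Prop :=
  ∃ (κ' ρ C C_A C_R C_s C_B γB : ℝ), 0 < κ' ∧ 0 < ρ ∧ 0 ≤ C ∧ 0 ≤ C_A ∧ 0 ≤ C_R ∧ 0 ≤ C_s ∧ 0 ≤ C_B ∧ 0 < γB ∧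
    ∀ (F : T3Family) (γ : ℝ) (hF : F.L = L) (hγ : 0 < γ), γ ≤ γB → ∀ (hγ1 : γ ≤ (min (hF ▸ 𝔠).gamma0 1) ^ 2),
      ∃ (Ψ : ChartFam ↥(lieC (suGroupModel 2)) F) (BR : CfgFam ↥(lieC (suGroupModel 2)) F), KerHeightFree Ψ ∧ RefCfgCoherent BR ∧
        (AlphaInputsT3AC.OfV3At F (hF ▸ 𝔠) a₀ a₁ →
          ∃ (p : ∀ K, AlphaInputsT3AC.PkgAtV3 F (hF ▸ 𝔠) γ hγ hγ1 K), (∀ K, (p K).a₀ = a₀ ∧ (p K).a₁ = a₁) ∧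
            ∃ (Φ : ChartFam ↥(lieC (suGroupModel 2)) F) (e : VacFam F) (B : CfgFam ↥(lieC (suGroupModel 2)) F),
              KernelRefOwnΦ (AlphaInputsT3AC.dataOfV3 p (canonPolymer p)) Φ Ψ (canonLegDist F) κ' (hF ▸ 𝔠).κ a C ∧
              ChartAnalyticΦ (AlphaInputsT3AC.dataOfV3 p (canonPolymer p)) (rescaleΦw (canonLegDist F) κ' Φ) (hF ▸ 𝔠).κ ρ C_A ∧
              RemainderSmallOwnΦ (AlphaInputsT3AC.dataOfV3 p (canonPolymer p)) (residualRem p Φ e B) (hF ▸ 𝔠).b₀ (hF ▸ 𝔠).p₀ (hF ▸ 𝔠).κ C_R ∧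
              CfgDistOwnΦ (AlphaInputsT3AC.dataOfV3 p (canonPolymer p)) B (canonLegDist F) (hF ▸ 𝔠).b₀ (hF ▸ 𝔠).p₀ C_s ∧
              CfgRefOwnΦ (AlphaInputsT3AC.dataOfV3 p (canonPolymer p)) B BR (canonLegDist F) (hF ▸ 𝔠).b₀ (hF ▸ 𝔠).p₀ a C_B)

/-- **DISPLAY LEVEL GIVES THE WEIGHTED PER-RUN FORM, OLD RECORD**: `K1aLegRowsOwnA → K1aLegRowsOwnE` with `C_E := C_A·max(1,12/ρ)⁶` (`kernelLegΦ_of_chartAnalyticLeg`).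
[cite: Balaban1985UV3, Prop. 3 (34) p.264; Chae1985, 13.6] -/
theorem k1aLegRowsOwnE_of_OwnA {L : ℕ} {𝔠 : AlphaConsts L (suGroupModel 2).N} {a₀ a₁ a : ℝ} (h : K1aLegRowsOwnA L 𝔠 a₀ a₁ a) :
    K1aLegRowsOwnE L 𝔠 a₀ a₁ a := by
  obtain ⟨κ', ρ, C, C_A, C_R, C_s, C_B, γB, hκ', hρ, hC, hCA, hCR, hCs, hCB, hγB, hall⟩ := h
  refine ⟨κ', C, C_A * (max 1 (12 / ρ)) ^ 6, C_R, C_s, C_B, γB, hκ', hC, by positivity, hCR, hCs, hCB, hγB, fun F γ hF hγ hγle hγ1 => ?_⟩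
  obtain ⟨Ψ, BR, hΨ, hBR, himp⟩ := hall F γ hF hγ hγle hγ1
  refine ⟨Ψ, BR, hΨ, hBR, fun hOf => ?_⟩
  obtain ⟨p, hp, Φ, e, B, hK, hA, hR, hS, hBC⟩ := himp hOf
  exact ⟨p, hp, Φ, e, B, hK, kernelLegΦ_of_chartAnalyticLeg hA, hR, hS, hBC⟩

/-- **THE REGISTERED v5k STUB 3⁗ FROM THE ALL-OWN WEIGHTED FORM OVER THE OLD RECORD, BY NAME** (`globalTwoRunSlackFam_of_k1aLegRowsE ∘ k1aLegRowsE_of_OwnE`).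
[cite: King1986, Thm 3.4 (3.9) p.656, Prop. 3.6 (3.56) p.662; Balaban1985UV3, (43)-(46) pp.266-267, (57) p.270] -/
theorem globalTwoRunSlackFam_of_k1aLegRowsOwnE
    (h : ∀ (L : ℕ), Odd L → 7 ≤ L → ∀ (𝔠 : AlphaConsts L (suGroupModel 2).N) (a₀ a₁ : ℝ), 0 < a₀ → 0 < a₁ → 𝔠.B₃ * a₁ ≤ a₀ →
      ∃ a : ℝ, 0 < a ∧ a < 1 ∧ K1aLegRowsOwnE L 𝔠 a₀ a₁ a) :
    ∀ (L : ℕ), Odd L → 7 ≤ L → ∀ (𝔠 : Summit.QuantumFields.Balaban3D.Proofs.Primitives.AlphaConsts L (Summit.QuantumFields.Balaban3D.Carriers.suGroupModel 2).N)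
      (a₀ a₁ : ℝ), 0 < a₀ → 0 < a₁ → 𝔠.B₃ * a₁ ≤ a₀ →
      ∃ a : ℝ, 0 < a ∧ ∃ γB : ℝ, 0 < γB ∧ ∀ (F : T3Family) (γ : ℝ) (hF : F.L = L) (hγ : 0 < γ), γ ≤ γB →
        ∀ (hγ1 : γ ≤ (min (hF ▸ 𝔠).gamma0 1) ^ 2),
          Summit.QuantumFields.YangMills.Theorems.AlphaInputsT3AC.OfV3At F (hF ▸ 𝔠) a₀ a₁ →
          ∃ (p : ∀ K, Summit.QuantumFields.YangMills.Theorems.AlphaInputsT3AC.PkgAtV3 F (hF ▸ 𝔠) γ hγ hγ1 K),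
            (∀ K, (p K).a₀ = a₀ ∧ (p K).a₁ = a₁) ∧
            ∃ (π : Summit.QuantumFields.YangMills.Theorems.AlphaInputsT3AC.PolymerT3 F) (σ : ℕ) (C : ℝ), 7 ≤ σ ∧ 0 ≤ C ∧
              Summit.QuantumFields.YangMills.Theorems.GlobalSlack.GlobalSupRateTSlack (Summit.QuantumFields.YangMills.Theorems.AlphaInputsT3AC.dataOfV3 p π) (hF ▸ 𝔠).b₀ (hF ▸ 𝔠).p₀ a σ C :=
  globalTwoRunSlackFam_of_k1aLegRowsE fun L hLo h7 𝔠 a₀ a₁ ha0 ha1 hw => by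
    obtain ⟨a, ha, ha1', hc⟩ := h L hLo h7 𝔠 a₀ a₁ ha0 ha1 hw
    exact ⟨a, ha, ha1', k1aLegRowsE_of_OwnE ha.le hc⟩

/-- **THE REGISTERED v5k STUB 3⁗ FROM THE DISPLAY-LEVEL PER-RUN FORM OVER THE OLD RECORD, BY NAME** (`… ∘ k1aLegRowsOwnE_of_OwnA`): five `∀ K`-rows about ONE run each —
kernel closeness to a fixed height-free reference, leg-weighted analyticity, the seventh-order residual row, (44) in distance form, loop-variable closeness to a fixed coherent
reference — imply the REGISTERED text of `stub_globalTwoRunSlackFam` (skeleton v5k) VERBATIM. [cite: King1986, Thm 3.4 (3.9) p.656, Prop. 3.6 (3.56) p.662; Balaban1985UV3, (25) p.262, (43)-(46) pp.266-267, (57) p.270] -/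
theorem globalTwoRunSlackFam_of_k1aLegRowsOwnA
    (h : ∀ (L : ℕ), Odd L → 7 ≤ L → ∀ (𝔠 : AlphaConsts L (suGroupModel 2).N) (a₀ a₁ : ℝ), 0 < a₀ → 0 < a₁ → 𝔠.B₃ * a₁ ≤ a₀ →
      ∃ a : ℝ, 0 < a ∧ a < 1 ∧ K1aLegRowsOwnA L 𝔠 a₀ a₁ a) :
    ∀ (L : ℕ), Odd L → 7 ≤ L → ∀ (𝔠 : Summit.QuantumFields.Balaban3D.Proofs.Primitives.AlphaConsts L (Summit.QuantumFields.Balaban3D.Carriers.suGroupModel 2).N)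
      (a₀ a₁ : ℝ), 0 < a₀ → 0 < a₁ → 𝔠.B₃ * a₁ ≤ a₀ →
      ∃ a : ℝ, 0 < a ∧ ∃ γB : ℝ, 0 < γB ∧ ∀ (F : T3Family) (γ : ℝ) (hF : F.L = L) (hγ : 0 < γ), γ ≤ γB →
        ∀ (hγ1 : γ ≤ (min (hF ▸ 𝔠).gamma0 1) ^ 2),
          Summit.QuantumFields.YangMills.Theorems.AlphaInputsT3AC.OfV3At F (hF ▸ 𝔠) a₀ a₁ →
          ∃ (p : ∀ K, Summit.QuantumFields.YangMills.Theorems.AlphaInputsT3AC.PkgAtV3 F (hF ▸ 𝔠) γ hγ hγ1 K),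
            (∀ K, (p K).a₀ = a₀ ∧ (p K).a₁ = a₁) ∧
            ∃ (π : Summit.QuantumFields.YangMills.Theorems.AlphaInputsT3AC.PolymerT3 F) (σ : ℕ) (C : ℝ), 7 ≤ σ ∧ 0 ≤ C ∧
              Summit.QuantumFields.YangMills.Theorems.GlobalSlack.GlobalSupRateTSlack (Summit.QuantumFields.YangMills.Theorems.AlphaInputsT3AC.dataOfV3 p π) (hF ▸ 𝔠).b₀ (hF ▸ 𝔠).p₀ a σ C :=
  globalTwoRunSlackFam_of_k1aLegRowsOwnE fun L hLo h7 𝔠 a₀ a₁ ha0 ha1 hw => by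
    obtain ⟨a, ha, ha1', hc⟩ := h L hLo h7 𝔠 a₀ a₁ ha0 ha1 hw
    exact ⟨a, ha, ha1', k1aLegRowsOwnE_of_OwnA hc⟩

end Summit.QuantumFields.YangMills.Theorems.GlobalSlackKernelLeg

end
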